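import Literature.RepresentationTheory.HeisenbergGroup.WeylSystemVacuumSubspace
import Literature.RepresentationTheory.Unitary.GramIsometryExtension
import HarnessLib

/-!
# A Weyl system is determined by its vacuum subspace: unitary maps between vacuum subspaces extend uniquely to intertwiners (von Neumann 1931, §5)

Topic `RepresentationTheory/HeisenbergGroup`; namespace `Literature.RepresentationTheory.HeisenbergGroup`.

Continuation of `WeylSystemVacuumSubspace`.  Let `W₁`, `W₂` be Weyl systems over the same phase space `(V, J)` on
Hilbert spaces `E₁`, `E₂`, with vacuum subspaces `M₁`, `M₂`.  By the coefficient formula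
`⟪W(x) m, W(y) m'⟫ = 𝐞(½⟪y, Jx⟫) γ(x − y) ⟪m, m'⟫` and the totality of the translates `W(x) M`, the families
`(x, m) ↦ W₁(x) m` and `(x, m) ↦ W₂(x) (T m)` have the same Gram matrix for any linear isometry `T : M₁ → M₂`, and are
total when `T` is onto.  Hence (`GramIsometryExtension`):

* **`exists_linearIsometryEquiv_of_vacuumIsometry`** — every linear isometry `T` of `M₁` ONTO `M₂` extends to a
  unitary `U : E₁ ≃ₗᵢ[ℂ] E₂` with `U (W₁(x) m) = W₂(x) (T m)`, and `U` intertwines: `U ∘ W₁(x) = W₂(x) ∘ U`.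

This is von Neumann's "`E ≅ L² ⊗ M₀`" in intertwiner form (Math. Ann. 104, §5): the unitary equivalence class of a
Weyl system is the dimension of its vacuum subspace; and it is the gluing step for commuting Weyl systems (a second
action commuting with `W` lives on `M₀`, `WeylSystemVacuumSubspace` §4).  Everything is PROVED (Mathlib + tree).

## References

* [vonNeumann1931] J. von Neumann, Die Eindeutigkeit der Schrödingerschen Operatoren, Math. Ann. 104 (1931)
  570–578, §5.
* [Folland1989] G. B. Folland, *Harmonic Analysis in Phase Space*, Princeton University Press, 1989, §1.5
  Theorem (1.50) (doi:10.1515/9781400882427).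
-/

noncomputable section

open MeasureTheory Complex Filter
open scoped InnerProductSpace FourierTransform ComplexConjugate Topology

namespace Literature.RepresentationTheory.HeisenbergGroup

open Literature.RepresentationTheory.Unitary

variable {V : Type*} [NormedAddCommGroup V] [InnerProductSpace ℝ V] [FiniteDimensional ℝ V]
  [MeasurableSpace V] [BorelSpace V]
variable {E₁ : Type*} [NormedAddCommGroup E₁] [InnerProductSpace ℂ E₁] [CompleteSpace E₁]
variable {E₂ : Type*} [NormedAddCommGroup E₂] [InnerProductSpace ℂ E₂] [CompleteSpace E₂]

namespace IsWeylSystem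

variable {J : V →ₗ[ℝ] V} {W₁ : V → E₁ →L[ℂ] E₁} {W₂ : V → E₂ →L[ℂ] E₂}

/-- The translates of the vacuum subspace as a family indexed by `V × M₀` span a dense subspace.
[cite: vonNeumann1931, §5] -/
theorem dense_span_range_apply_vacuum (hW : IsWeylSystem J W₁) :
    Dense (Submodule.span ℂ (Set.range fun p : V × hW.vacuumSubspace => W₁ p.1 (p.2 : E₁)) : Set E₁) := by
  have hsub : {w : E₁ | ∃ (x : V) (m : E₁), m ∈ hW.vacuumSubspace ∧ w = W₁ x m} ⊆
      Set.range fun p : V × hW.vacuumSubspace => W₁ p.1 (p.2 : E₁) := by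
    rintro _ ⟨x, m, hm, rfl⟩
    exact ⟨(x, ⟨m, hm⟩), rfl⟩
  exact (hW.dense_span_apply_vacuumSubspace).mono (Submodule.span_mono hsub)

/-- **A linear isometry of the vacuum subspace of `W₁` onto that of `W₂` extends to a unitary intertwiner**
`U : E₁ ≃ₗᵢ[ℂ] E₂`, `U (W₁(x) m) = W₂(x) (T m)`, `U ∘ W₁(x) = W₂(x) ∘ U` (Gram equality of the families
`W₁(x) m`, `W₂(x) (T m)` by the vacuum coefficient formula; totality; `GramIsometryExtension`).
[cite: vonNeumann1931, §5; Folland1989, §1.5 Theorem (1.50)] -/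
theorem exists_linearIsometryEquiv_of_vacuumIsometry (hW₁ : IsWeylSystem J W₁) (hW₂ : IsWeylSystem J W₂)
    (T : hW₁.vacuumSubspace →ₗᵢ[ℂ] E₂) (hT : ∀ m, T m ∈ hW₂.vacuumSubspace)
    (hTs : ∀ m₂ ∈ hW₂.vacuumSubspace, ∃ m₁ : hW₁.vacuumSubspace, T m₁ = m₂) :
    ∃ U : E₁ ≃ₗᵢ[ℂ] E₂, (∀ (x : V) (m : hW₁.vacuumSubspace), U (W₁ x (m : E₁)) = W₂ x (T m)) ∧
      ∀ (x : V) (v : E₁), U (W₁ x v) = W₂ x (U v) := by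
  set f₁ : V × hW₁.vacuumSubspace → E₁ := fun p => W₁ p.1 (p.2 : E₁) with hf₁
  set f₂ : V × hW₁.vacuumSubspace → E₂ := fun p => W₂ p.1 (T p.2) with hf₂
  -- equal Gram matrices
  have hgram : ∀ i j, ⟪f₁ i, f₁ j⟫_ℂ = ⟪f₂ i, f₂ j⟫_ℂ := by
    rintro ⟨x, m⟩ ⟨y, m'⟩
    simp only [hf₁, hf₂]
    rw [hW₁.inner_apply_apply_of_mem_vacuumSubspace m.2 m'.2,
      hW₂.inner_apply_apply_of_mem_vacuumSubspace (hT m) (hT m'), T.inner_map_map, Submodule.coe_inner]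
  -- totality of the second family: it is the family of all translates of `M₂`
  have hd₂ : Dense (Submodule.span ℂ (Set.range f₂) : Set E₂) := by
    have hsub : {w : E₂ | ∃ (x : V) (m : E₂), m ∈ hW₂.vacuumSubspace ∧ w = W₂ x m} ⊆ Set.range f₂ := by
      rintro _ ⟨x, m₂, hm₂, rfl⟩
      obtain ⟨m₁, hm₁⟩ := hTs m₂ hm₂
      exact ⟨(x, m₁), by simp only [hf₂, hm₁]⟩
    exact (hW₂.dense_span_apply_vacuumSubspace).mono (Submodule.span_mono hsub)
  obtain ⟨U, hU⟩ := exists_linearIsometryEquiv_of_inner_eq f₁ f₂ hgram hW₁.dense_span_range_apply_vacuum hd₂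
  have hUgen : ∀ (x : V) (m : hW₁.vacuumSubspace), U (W₁ x (m : E₁)) = W₂ x (T m) := fun x m => hU (x, m)
  refine ⟨U, hUgen, fun x => ?_⟩
  -- the intertwining relation holds on the total family, hence everywhere
  have key : (U.toContinuousLinearEquiv : E₁ →L[ℂ] E₂).comp (W₁ x) =
      (W₂ x).comp (U.toContinuousLinearEquiv : E₁ →L[ℂ] E₂) := by
    refine continuousLinearMap_eq_of_eqOn_of_dense f₁ hW₁.dense_span_range_apply_vacuum _ _ ?_
    rintro ⟨y, m⟩
    simp only [hf₁, ContinuousLinearMap.comp_apply]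
    change U (W₁ x (W₁ y (m : E₁))) = W₂ x (U (W₁ y (m : E₁)))
    rw [hW₁.mul, map_smul, hUgen, hUgen, hW₂.mul]
  intro v
  have := congrArg (fun Φ : E₁ →L[ℂ] E₂ => Φ v) key
  simpa using this

end IsWeylSystem

end Literature.RepresentationTheory.HeisenbergGroup

end
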